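import Mathlib
import HarnessLib
import Summits.HubbardSuperconductivity.HubbardSuperconductivity.Theorems.KLProgrammeC4aValueBridge

/-!
# Route `KLProgramme` — crux C4a, value layer (L3-val): ADDITIVITY of the angular average in the vertex and the odd-difference dominator of a
# DECOMPOSED vertex (`V± = Σ pieces + remainder`) — the glue between the per-piece bridges and the `hd` of `norm_sum_tubeTadpoles_le_of_oddDiff`

Cell `gate-hubbard-kl`, lane hubbard-kl-k3c3-p3 (g14); helper for stub (C) `stub_twoLeg_curvature` of `KLRegimeEngineV17F2` (stmt-HubbardSuperconductivity-20437),
`k = 0` VALUE clause (located risk #12 «(C)-VALUE-K0»).  Companion of `…C4aValueBridge`: the second-order tadpole vertex is a SUM (c4a-1 `…C4aVertexSecondOrderSplit`,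
`…C4aSecondCumulantTadpoleLegs`: constant − ½·(pp bubble at `k+q` + ph bubbles at `k−q` + trees) + third order), the (A)-closer consumes ONE dominator
`d_{p₀}(ρ)` for the whole vertex pair `(V_{p₀}, V_{p₀.rev})`.  This file turns per-piece dominators into that one:

* §1 `tubeAngularAvg_add/_sub/_smul/_finset_sum` — the angular average is linear in the vertex (given integrability of the chart-side integrands;
  `integrableOn_jac_smul_vertex_of_continuous` supplies it for any vertex continuous in the loop momentum);
* §2 **`norm_tubeAngularAvg_pair_le_of_pieces`** — if `Vp = Σ_{i∈s} P i + Rp`, `Vm = Σ_{i∈s} P i + Rm` (the SAME symmetric pieces on both sides) with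
  `‖avg(P i) θ ρ − avg(P i) θ (−ρ)‖ ≤ D i·|ρ|` for each piece (e.g. `…C4aValueBridge.norm_tubeAngularAvg_pairSum/pairDiff_sub_neg_le`, or c4a-1's constant-vertex
  row) and `‖avg Rp θ ρ − avg Rm θ (−ρ)‖ ≤ dR ρ` for the remainder, then `‖avg Vp θ ρ − avg Vm θ (−ρ)‖ ≤ (Σ_{i∈s} D i)·|ρ| + dR ρ` — the `hd` shape.

Pure bookkeeping (linearity of the Bochner integral); nothing about the Hubbard model; nothing asserts superconductivity.
References: BGM 2006 §2.4 (2.36) [cite: BenfattoGiulianiMastropietro2006].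
-/

noncomputable section

namespace Summit.HubbardSuperconductivity.HubbardSuperconductivity.Theorems.C4a

set_option linter.dupNamespace false -- summit = problem name (single-conjunct summit), D-0017

open Real Set MeasureTheory Filter Finset
open scoped ContDiff Topology
open Literature.MathematicalPhysics.QuantumLattice Literature.MathematicalPhysics.QuantumLattice.BandSectorCounting Literature.Probability.LatticeModels
open Summit.HubbardSuperconductivity.HubbardSuperconductivity.Theorems.KLRegimeSplit
open Summit.HubbardSuperconductivity.HubbardSuperconductivity.Theorems.DispersionFlow
open Summit.HubbardSuperconductivity.HubbardSuperconductivity.Theorems.PerturbedFermiCurve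

/-! ## §1 Linearity of the angular average in the vertex -/

/-- **Additivity**: `avg(V + W) = avg V + avg W` (chart-side integrands integrable on the loop-angle window). -/
theorem tubeAngularAvg_add (μ : ℝ) (K : TrigPolyC4v) {V W : Momentum → Momentum → ℂ} (θ ρ : ℝ)
    (hV : IntegrableOn (fun ϑ => levelChartJac μ K (ρ, ϑ) • V (levelPoint μ K 0 θ) (levelPoint μ K ρ ϑ)) (Ioc 0 (2 * π)))
    (hW : IntegrableOn (fun ϑ => levelChartJac μ K (ρ, ϑ) • W (levelPoint μ K 0 θ) (levelPoint μ K ρ ϑ)) (Ioc 0 (2 * π))) :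
    tubeAngularAvg μ K (fun k q => V k q + W k q) θ ρ = tubeAngularAvg μ K V θ ρ + tubeAngularAvg μ K W θ ρ := by
  simp only [tubeAngularAvg_apply, smul_add]
  exact integral_add hV hW

/-- **Subtraction**: `avg(V − W) = avg V − avg W`. -/
theorem tubeAngularAvg_sub (μ : ℝ) (K : TrigPolyC4v) {V W : Momentum → Momentum → ℂ} (θ ρ : ℝ)
    (hV : IntegrableOn (fun ϑ => levelChartJac μ K (ρ, ϑ) • V (levelPoint μ K 0 θ) (levelPoint μ K ρ ϑ)) (Ioc 0 (2 * π)))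
    (hW : IntegrableOn (fun ϑ => levelChartJac μ K (ρ, ϑ) • W (levelPoint μ K 0 θ) (levelPoint μ K ρ ϑ)) (Ioc 0 (2 * π))) :
    tubeAngularAvg μ K (fun k q => V k q - W k q) θ ρ = tubeAngularAvg μ K V θ ρ - tubeAngularAvg μ K W θ ρ := by
  simp only [tubeAngularAvg_apply, smul_sub]
  exact integral_sub hV hW

/-- **Homogeneity**: `avg(c·V) = c·avg V` (no integrability needed). -/
theorem tubeAngularAvg_const_mul (μ : ℝ) (K : TrigPolyC4v) (c : ℂ) (V : Momentum → Momentum → ℂ) (θ ρ : ℝ) :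
    tubeAngularAvg μ K (fun k q => c * V k q) θ ρ = c * tubeAngularAvg μ K V θ ρ := by
  simp only [tubeAngularAvg_apply]
  rw [← integral_const_mul]
  refine setIntegral_congr_fun measurableSet_Ioc fun ϑ _ => ?_
  simp only [Complex.real_smul]
  ring

/-- **Finite sums**: `avg(Σ_{i∈s} P i) = Σ_{i∈s} avg(P i)`. -/
theorem tubeAngularAvg_finset_sum {ι : Type*} (μ : ℝ) (K : TrigPolyC4v) (s : Finset ι) {P : ι → Momentum → Momentum → ℂ} (θ ρ : ℝ)
    (hP : ∀ i ∈ s, IntegrableOn (fun ϑ => levelChartJac μ K (ρ, ϑ) • P i (levelPoint μ K 0 θ) (levelPoint μ K ρ ϑ)) (Ioc 0 (2 * π))) :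
    tubeAngularAvg μ K (fun k q => ∑ i ∈ s, P i k q) θ ρ = ∑ i ∈ s, tubeAngularAvg μ K (P i) θ ρ := by
  simp only [tubeAngularAvg_apply, Finset.smul_sum]
  rw [integral_finsetSum s hP]

section Frame

variable {a b : ℝ} (B : BandBounds a b) {K : TrigPolyC4v} {A : ℝ}
  (hA : ∀ p : Momentum, ∀ j ≤ 2, ‖iteratedFDeriv ℝ j (frameShift K) p‖ ≤ A) (hADt : 2 * A < B.Dtmin)
  {μ r : ℝ} (hlo : a < μ - r - A) (hhi : μ + r + A < b)
include B hA hADt hlo hhi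

/-- **Integrability from continuity in the loop momentum**: if `q ↦ V(Φ(0,θ), q)` is continuous, the chart-side integrand is integrable on every level
circle of the tube. -/
theorem integrableOn_jac_smul_vertex_of_continuous {V : Momentum → Momentum → ℂ} (θ : ℝ) (hV : Continuous fun q : Momentum => V (levelPoint μ K 0 θ) q)
    {ρ : ℝ} (hρ : ρ ∈ Ioo (-r) r) :
    IntegrableOn (fun ϑ => levelChartJac μ K (ρ, ϑ) • V (levelPoint μ K 0 θ) (levelPoint μ K ρ ϑ)) (Ioc 0 (2 * π)) := by
  have hΦ : Continuous fun ϑ : ℝ => levelPoint μ K ρ ϑ := (contDiff_levelPoint_angle B hA hADt hlo hhi (abs_lt.2 ⟨hρ.1, hρ.2⟩) (m := 0)).continuous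
  have hc : Continuous fun ϑ : ℝ => levelChartJac μ K (ρ, ϑ) • V (levelPoint μ K 0 θ) (levelPoint μ K ρ ϑ) :=
    (continuous_levelChartJac_angle B hA hADt hlo hhi hρ).smul (hV.comp hΦ)
  exact (hc.continuousOn.integrableOn_Icc (a := 0) (b := 2 * π)).mono_set Ioc_subset_Icc_self

end Frame

/-! ## §2 The dominator of a decomposed vertex pair -/

/-- **THE ODD-DIFFERENCE DOMINATOR OF A DECOMPOSED VERTEX PAIR.**  On a level `ρ`, let `Vp = Σ_{i∈s} P i + Rp` and `Vm = Σ_{i∈s} P i + Rm` hold along the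
chart (as functions of `(k, q)`), with all chart-side integrands integrable at levels `ρ` and `−ρ`.  If every symmetric piece has a LINEAR odd-difference
dominator, `‖avg(P i) θ ρ − avg(P i) θ (−ρ)‖ ≤ D i·|ρ|`, and the remainders satisfy `‖avg Rp θ ρ − avg Rm θ (−ρ)‖ ≤ dR`, then
`‖avg Vp θ ρ − avg Vm θ (−ρ)‖ ≤ (Σ_{i∈s} D i)·|ρ| + dR` — the `hd` of `…C4aTadpoleValueAssembly.norm_sum_tubeTadpoles_le_of_oddDiff` assembled from pieces
(the `P i` come from `…C4aValueBridge.norm_tubeAngularAvg_pairSum/pairDiff_sub_neg_le`; a `θ`-blind piece contributes through c4a-1's constant-vertex row). -/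
theorem norm_tubeAngularAvg_pair_le_of_pieces {ι : Type*} (μ : ℝ) (K : TrigPolyC4v) (s : Finset ι) {P : ι → Momentum → Momentum → ℂ}
    {Vp Vm Rp Rm : Momentum → Momentum → ℂ} (θ ρ : ℝ) (hVp : ∀ k q, Vp k q = (∑ i ∈ s, P i k q) + Rp k q)
    (hVm : ∀ k q, Vm k q = (∑ i ∈ s, P i k q) + Rm k q)
    (hPi : ∀ i ∈ s, ∀ σ ∈ ({ρ, -ρ} : Set ℝ), IntegrableOn (fun ϑ => levelChartJac μ K (σ, ϑ) • P i (levelPoint μ K 0 θ) (levelPoint μ K σ ϑ)) (Ioc 0 (2 * π)))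
    (hRp : IntegrableOn (fun ϑ => levelChartJac μ K (ρ, ϑ) • Rp (levelPoint μ K 0 θ) (levelPoint μ K ρ ϑ)) (Ioc 0 (2 * π)))
    (hRm : IntegrableOn (fun ϑ => levelChartJac μ K (-ρ, ϑ) • Rm (levelPoint μ K 0 θ) (levelPoint μ K (-ρ) ϑ)) (Ioc 0 (2 * π)))
    {D : ι → ℝ} (hD : ∀ i ∈ s, ‖tubeAngularAvg μ K (P i) θ ρ - tubeAngularAvg μ K (P i) θ (-ρ)‖ ≤ D i * |ρ|) {dR : ℝ}
    (hR : ‖tubeAngularAvg μ K Rp θ ρ - tubeAngularAvg μ K Rm θ (-ρ)‖ ≤ dR) :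
    ‖tubeAngularAvg μ K Vp θ ρ - tubeAngularAvg μ K Vm θ (-ρ)‖ ≤ (∑ i ∈ s, D i) * |ρ| + dR := by
  have hρmem : ρ ∈ ({ρ, -ρ} : Set ℝ) := Set.mem_insert _ _
  have hρmem' : -ρ ∈ ({ρ, -ρ} : Set ℝ) := Set.mem_insert_of_mem _ (Set.mem_singleton _)
  have hSp : IntegrableOn (fun ϑ => levelChartJac μ K (ρ, ϑ) • (fun k q => ∑ i ∈ s, P i k q) (levelPoint μ K 0 θ) (levelPoint μ K ρ ϑ))
      (Ioc 0 (2 * π)) := by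
    have h : IntegrableOn (fun ϑ => ∑ i ∈ s, levelChartJac μ K (ρ, ϑ) • P i (levelPoint μ K 0 θ) (levelPoint μ K ρ ϑ)) (Ioc 0 (2 * π)) :=
      integrable_finsetSum s fun i hi => hPi i hi ρ hρmem
    exact h.congr_fun (fun ϑ _ => by simp only [Finset.smul_sum]) measurableSet_Ioc
  have hSm : IntegrableOn (fun ϑ => levelChartJac μ K (-ρ, ϑ) • (fun k q => ∑ i ∈ s, P i k q) (levelPoint μ K 0 θ) (levelPoint μ K (-ρ) ϑ))
      (Ioc 0 (2 * π)) := by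
    have h : IntegrableOn (fun ϑ => ∑ i ∈ s, levelChartJac μ K (-ρ, ϑ) • P i (levelPoint μ K 0 θ) (levelPoint μ K (-ρ) ϑ)) (Ioc 0 (2 * π)) :=
      integrable_finsetSum s fun i hi => hPi i hi (-ρ) hρmem'
    exact h.congr_fun (fun ϑ _ => by simp only [Finset.smul_sum]) measurableSet_Ioc
  have eVp : tubeAngularAvg μ K Vp θ ρ = (∑ i ∈ s, tubeAngularAvg μ K (P i) θ ρ) + tubeAngularAvg μ K Rp θ ρ := by
    have h1 : tubeAngularAvg μ K Vp θ ρ = tubeAngularAvg μ K (fun k q => (fun k q => ∑ i ∈ s, P i k q) k q + Rp k q) θ ρ := by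
      simp only [tubeAngularAvg_apply, hVp]
    rw [h1, tubeAngularAvg_add μ K (V := fun k q => ∑ i ∈ s, P i k q) (W := Rp) θ ρ hSp hRp, add_left_inj]
    exact tubeAngularAvg_finset_sum μ K s (P := P) θ ρ fun i hi => hPi i hi ρ hρmem
  have eVm : tubeAngularAvg μ K Vm θ (-ρ) = (∑ i ∈ s, tubeAngularAvg μ K (P i) θ (-ρ)) + tubeAngularAvg μ K Rm θ (-ρ) := by
    have h1 : tubeAngularAvg μ K Vm θ (-ρ) = tubeAngularAvg μ K (fun k q => (fun k q => ∑ i ∈ s, P i k q) k q + Rm k q) θ (-ρ) := by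
      simp only [tubeAngularAvg_apply, hVm]
    rw [h1, tubeAngularAvg_add μ K (V := fun k q => ∑ i ∈ s, P i k q) (W := Rm) θ (-ρ) hSm hRm, add_left_inj]
    exact tubeAngularAvg_finset_sum μ K s (P := P) θ (-ρ) fun i hi => hPi i hi (-ρ) hρmem'
  have hre : (∑ i ∈ s, tubeAngularAvg μ K (P i) θ ρ) + tubeAngularAvg μ K Rp θ ρ -
      ((∑ i ∈ s, tubeAngularAvg μ K (P i) θ (-ρ)) + tubeAngularAvg μ K Rm θ (-ρ)) =
      (∑ i ∈ s, (tubeAngularAvg μ K (P i) θ ρ - tubeAngularAvg μ K (P i) θ (-ρ))) + (tubeAngularAvg μ K Rp θ ρ - tubeAngularAvg μ K Rm θ (-ρ)) := by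
    rw [Finset.sum_sub_distrib]; abel
  rw [eVp, eVm, hre]
  calc _ ≤ ‖∑ i ∈ s, (tubeAngularAvg μ K (P i) θ ρ - tubeAngularAvg μ K (P i) θ (-ρ))‖ + ‖tubeAngularAvg μ K Rp θ ρ - tubeAngularAvg μ K Rm θ (-ρ)‖ :=
        norm_add_le _ _
    _ ≤ (∑ i ∈ s, D i * |ρ|) + dR := add_le_add ((norm_sum_le _ _).trans (Finset.sum_le_sum hD)) hR
    _ = (∑ i ∈ s, D i) * |ρ| + dR := by rw [Finset.sum_mul]

end Summit.HubbardSuperconductivity.HubbardSuperconductivity.Theorems.C4a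

end
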